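import Summits.KontsevichZagierPeriods.Zeta5Search.Barrier.ConeGammaTranslateChamberMoments

/-!
# ζ(5) search — BARRIER: THE FIRST-MOMENT SUM RULE — `Σ_k m_k(δ) = T·𝒩(δ) − P(δ)` at every translate with a margin (the
# `m`-analogue of `Σ_k J_k = 0`: time reparametrisation read through the tilt theorem); at a coherent translate the junction first
# moments of the closed orbit add up to a closed-orbit constant (file (5) of «THE CLOSED-ORBIT LIMIT»)

HONEST FRAMING (cell `pub-zeta5`): systematic search; no irrationality claim unless kernel-certified. MODEL objects
under Brown–Zudilin's (28)+(30) accounting ([BZ22] = arXiv:2210.03391; (28) observed, not proved); nothing here is a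
statement about `ζ(5)`, any `γ` of record, the cone's supremum (C2 OPEN) or the value / sign of any first moment, jump mass or
translate integral at a named direction (DATA of the cell); NO cancellation is quantified; S-E / (TD_A) stay CONJECTURED; records
in print UNMOVED. Prover P2 g41 (item «THE CLOSED-ORBIT LIMIT», file (5); plan INBOX 2026-08-28). Sources: P2 g40
`ConeGammaTranslateTilt` (THE TILT THEOREM `∫₀ᵀ[𝒩(u·(s(a)+η)+δ) − 𝒩(u·s(a)+δ)]du = Σ_k (φ_kη/(h_k+φ_kη))·m_k(δ)`),
`ConeGammaTranslateGradient` (`Σ_k J_k(δ) = 0` — flow invariance read through the gradient theorem), file (3)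
`ConeGammaTranslateChamberMoments` (on the coherent chamber `m_k(δ) = M_k − ρ_k·W_k + [0 < φ_kδ]·T·g_k(0)`).

* `torusN_line_eq_of_small` — with a margin at `δ` (`hend`: no crossing time within `r` of `0`), the saving is constant on the
  first stretch of the period: `𝒩(w·s(a) + δ) = 𝒩(δ)` for `0 ≤ w ≤ r/2`;
* **`sum_firstMoment_eq` — THE FIRST-MOMENT SUM RULE**: at EVERY translate `δ` with a margin `r` (`hsep`, `hend`),
  **`Σ_k m_k(δ) = T·𝒩(δ) − P(δ)`** (`P = translateIntegral a T`). Proof: the tilt `η = c·s(a)`, `c = r/(4T)`, is a TIME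
  REPARAMETRISATION `u ↦ (1+c)u` of the same orbit; the tilt theorem weights every `m_k` by the same factor `c/(1+c)`, while the
  left side is `(1+c)⁻¹·(P(δ) + c·T·𝒩(δ)) − P(δ)` (substitution, one period shift, constancy on `[0, cT]`). This is Abel summation
  along one period — `P(δ) = T·𝒩(θ_T⁻) − Σ_{crossings} s_c·J_c` — obtained without any pointwise bookkeeping, exactly as
  `Σ_k J_k = 0` was flow invariance read through the gradient theorem: the zeroth moments of the jumps sum to `0`, the first
  moments to `T·𝒩(δ) − P(δ)`;
* **`sum_junctionMoment_eq` — AT THE CLOSED ORBIT**: on the coherent chamber (files (2)–(3)), summing file (3)'s formula,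
  `Σ_k (M_k − ρ_k·W_k + [0 < φ_kδ]·T·g_k(0)) = T·𝒩(δ) − P(δ)` — the junction first moments `M_k`, the chamber weights and the
  lattice marginals of the closed orbit are tied to the saving AT the translate and the translate integral by one linear relation.
NOT here (honest): any value of `m_k`, `M_k`, `𝒩(δ)`, `P(δ)` at a named direction (DATA); weighted (`u⁻²`) versions; any
cancellation; `Φ`, `γ`, C2, S-E's truth, `ζ(5)`.
-/

noncomputable section

open Set MeasureTheory Finset
open scoped Topology

namespace Summit.KontsevichZagierPeriods.Zeta5Search.Barrier.ConeGamma

/-! ### The saving is constant on the first stretch of the period -/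

/-- **No crossing near the start**: with `hend` (no crossing time within `r` of `0`), for `0 ≤ w ≤ r/2` every floor
`⌊w·h_k + φ_kδ⌋` equals `⌊φ_kδ⌋`, so `𝒩(w·s(a) + δ) = 𝒩(δ)`. -/
theorem torusN_line_eq_of_small {a : Dir} (hpos : ∀ k, 0 < h28 a k) {δ : Fin 8 → ℝ} {r : ℝ}
    (hend : ∀ (k : Fin 28) (z : ℤ), r ≤ |((z : ℝ) - phiForm δ k) / h28 a k|) {w : ℝ} (hw0 : 0 ≤ w)
    (hwr : w ≤ r / 2) : torusN (w • sParam a + δ) = torusN δ := by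
  rw [torusN_eq_floorN, torusN_eq_floorN]
  congr 1
  funext k
  have hk := hpos k
  rw [phiForm_line, Int.floor_eq_iff]
  constructor
  · have h1 := Int.floor_le (phiForm δ k)
    have h2 : 0 ≤ w * h28 a k := mul_nonneg hw0 hk.le
    linarith
  · -- the next crossing `z₁ = ⌊φ_kδ⌋ + 1` is at time `(z₁ − φ_kδ)/h_k ≥ r`
    have hz := hend k (⌊phiForm δ k⌋ + 1)
    have hpos' : 0 < (((⌊phiForm δ k⌋ + 1 : ℤ) : ℝ) - phiForm δ k) / h28 a k := by
      apply div_pos _ hk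
      have := Int.lt_floor_add_one (phiForm δ k)
      push_cast; linarith
    rw [abs_of_pos hpos', le_div_iff₀ hk] at hz
    push_cast at hz ⊢
    have h3 : w * h28 a k ≤ r / 2 * h28 a k := mul_le_mul_of_nonneg_right hwr hk.le
    have h4 := Int.lt_floor_add_one (phiForm δ k)
    linarith

/-! ### The first-moment sum rule -/

/-- **THE FIRST-MOMENT SUM RULE.** All 28 forms of `a` positive, `T > 0` a period, `δ` a translate with a margin `r` (`hsep`,
`hend`). Then the first moments of the jumps of one period add up to
**`Σ_k m_k(δ) = T·𝒩(δ) − P(δ)`**, `m_k(δ) = Σ_{z∈S_k} s_{k,z}·J_{k,z}`, `P = translateIntegral a T` — the tilt theorem at the time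
reparametrisation `η = (r/(4T))·s(a)`. -/
theorem sum_firstMoment_eq {a : Dir} (hpos : ∀ k, 0 < h28 a k) {T : ℝ} (hT : 0 < T)
    (hper : ∀ k : Fin 28, ∃ z : ℤ, T * h28 a k = z) {δ : Fin 8 → ℝ} {r : ℝ} (hr : 0 < r)
    (hsep : ∀ (k k' : Fin 28) (z z' : ℤ), (k ≠ k' ∨ z ≠ z') →
      r ≤ |((z : ℝ) - phiForm δ k) / h28 a k - ((z' : ℝ) - phiForm δ k') / h28 a k'|)
    (hend : ∀ (k : Fin 28) (z : ℤ), r ≤ |((z : ℝ) - phiForm δ k) / h28 a k|) :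
    ∑ k : Fin 28, ∑ z ∈ Finset.Ioc ⌊phiForm δ k⌋ (⌊phiForm δ k⌋ + ⌊T * h28 a k⌋),
        ((z : ℝ) - phiForm δ k) / h28 a k *
          ((torusN ((((z : ℝ) - phiForm δ k) / h28 a k) • sParam a + δ) -
            torusN ((((z : ℝ) - phiForm δ k) / h28 a k - r / 2) • sParam a + δ) : ℤ) : ℝ) =
      T * (torusN δ : ℝ) - translateIntegral a T δ := by
  set c : ℝ := r / (4 * T) with hc
  have hc0 : 0 < c := by positivity
  have hc1 : (1 + c) ≠ 0 := by positivity
  -- the tilt along the direction itself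
  have hη : ∀ k, T * |phiForm (c • sParam a) k| ≤ r * h28 a k / 4 := fun k => by
    rw [phiForm_smul_sParam, abs_of_pos (mul_pos hc0 (hpos k)), hc]
    field_simp
    rfl
  have htilt := integral_tilt_sub_eq_sum_firstMoment hpos hT hper hr hsep hend hη
  -- right side: every weight is `c/(1+c)`
  have hw : ∀ k : Fin 28, phiForm (c • sParam a) k / (h28 a k + phiForm (c • sParam a) k) = c / (1 + c) := fun k => by
    rw [phiForm_smul_sParam]; field_simp [(hpos k).ne']
  simp only [hw, ← Finset.mul_sum] at htilt
  -- left side: time reparametrisation `u ↦ (1+c)·u`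
  set f : ℝ → ℝ := fun w => (torusN (w • sParam a + δ) : ℝ) with hf
  have hfi : ∀ α β, IntervalIntegrable f volume α β := intervalIntegrable_torusN_line a δ
  have hL1 : ∫ u in (0 : ℝ)..T, (torusN (u • (sParam a + c • sParam a) + δ) : ℝ) =
      (1 + c)⁻¹ * ∫ w in (0 : ℝ)..(1 + c) * T, f w := by
    have h := intervalIntegral.integral_comp_mul_left f hc1 (a := 0) (b := T)
    rw [mul_zero, smul_eq_mul] at h
    rw [← h]
    refine intervalIntegral.integral_congr fun u _ => ?_
    simp only [hf]
    congr 2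
    rw [smul_add, smul_smul, ← add_smul]; ring_nf
  have hL2 : ∫ w in (0 : ℝ)..(1 + c) * T, f w = translateIntegral a T δ + ∫ w in T..(1 + c) * T, f w := by
    rw [← intervalIntegral.integral_add_adjacent_intervals (hfi 0 T) (hfi T _)]
    rfl
  have hL3 : ∫ w in T..(1 + c) * T, f w = ∫ w in (0 : ℝ)..c * T, f w := by
    have h := intervalIntegral.integral_comp_add_right (a := 0) (b := c * T) f T
    rw [zero_add, show c * T + T = (1 + c) * T by ring] at h
    rw [← h]
    refine intervalIntegral.integral_congr fun w _ => ?_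
    exact periodic_torusN_line hper δ w
  have hL4 : ∫ w in (0 : ℝ)..c * T, f w = c * T * (torusN δ : ℝ) := by
    have hcT : c * T = r / 4 := by rw [hc]; field_simp
    have h : ∫ w in (0 : ℝ)..c * T, f w = ∫ w in (0 : ℝ)..c * T, (torusN δ : ℝ) := by
      refine intervalIntegral.integral_congr fun w hw => ?_
      rw [Set.uIcc_of_le (by positivity)] at hw
      simp only [hf]
      rw [torusN_line_eq_of_small hpos hend hw.1 (by linarith [hw.2])]
    rw [h, intervalIntegral.integral_const, smul_eq_mul, sub_zero]
  have hL : ∫ u in (0 : ℝ)..T, ((torusN (u • (sParam a + c • sParam a) + δ) : ℝ) - torusN (u • sParam a + δ)) =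
      (1 + c)⁻¹ * (translateIntegral a T δ + c * T * (torusN δ : ℝ)) - translateIntegral a T δ := by
    rw [intervalIntegral.integral_sub ((intervalIntegrable_torusN_line (aOfS (sParam a + c • sParam a)) δ 0 T).congr
      fun u _ => by rw [sParam_aOfS]) (hfi 0 T), hL1, hL2, hL3, hL4]
    rfl
  rw [hL] at htilt
  -- solve the linear relation for `Σ_k m_k`
  set S : ℝ := ∑ k : Fin 28, ∑ z ∈ Finset.Ioc ⌊phiForm δ k⌋ (⌊phiForm δ k⌋ + ⌊T * h28 a k⌋),
      ((z : ℝ) - phiForm δ k) / h28 a k *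
        ((torusN ((((z : ℝ) - phiForm δ k) / h28 a k) • sParam a + δ) -
          torusN ((((z : ℝ) - phiForm δ k) / h28 a k - r / 2) • sParam a + δ) : ℤ) : ℝ) with hS
  have key : c * S = c * (T * (torusN δ : ℝ) - translateIntegral a T δ) := by
    calc c * S = (1 + c) * (c / (1 + c) * S) := by field_simp
      _ = (1 + c) * ((1 + c)⁻¹ * (translateIntegral a T δ + c * T * (torusN δ : ℝ)) - translateIntegral a T δ) := by
          rw [htilt]
      _ = c * (T * (torusN δ : ℝ) - translateIntegral a T δ) := by field_simp; ring
  exact mul_left_cancel₀ hc0.ne' key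

/-! ### At the closed orbit: the junction first moments add up to a closed-orbit constant -/

/-- **THE SUM RULE AT THE CLOSED ORBIT.** On the coherent chamber (hypotheses of file (3)'s `firstMoment_eq_canonical`):
`Σ_k (M_k − ρ_k·W_k + [0 < φ_kδ]·T·g_k(0)) = T·𝒩(δ) − P(δ)` — file (3)'s chamber-data formula summed over the 28 forms and read
through the sum rule. -/
theorem sum_junctionMoment_eq {a : Dir} (hpos : ∀ k, 0 < h28 a k) {T : ℝ} (hT : 0 < T)
    (hper : ∀ k : Fin 28, ∃ z : ℤ, T * h28 a k = z) {F : Finset (Fin 28) → ℝ}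
    (hF : ∀ A, F A = ∑ m ∈ Finset.range ((bkpts a T).card - 1), ((patternN a (bkpt a T m) A : ℤ) : ℝ))
    {δ : Fin 8 → ℝ} {r : ℝ} (hr : 0 < r)
    (hsep : ∀ (k k' : Fin 28) (z z' : ℤ), (k ≠ k' ∨ z ≠ z') →
      r ≤ |((z : ℝ) - phiForm δ k) / h28 a k - ((z' : ℝ) - phiForm δ k') / h28 a k'|)
    (hend : ∀ (k : Fin 28) (z : ℤ), r ≤ |((z : ℝ) - phiForm δ k) / h28 a k|)
    {ρb : ℝ} (hρ : ∀ k, |phiForm δ k / h28 a k| ≤ ρb) (hc1 : (2 * ρb + r / 2) * xMax a < 1)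
    (hc2 : (2 * ρb + r / 2) * xMax a < wallDist a T) :
    ∑ k : Fin 28,
        (∑ m ∈ Finset.range ((bkpts a T).card - 1), bkpt a T m *
            (((patternN a (bkpt a T m)
                (Finset.univ.filter fun l => phiForm δ k / h28 a k ≤ phiForm δ l / h28 a l) : ℤ) : ℝ) -
              ((patternN a (bkpt a T m)
                (Finset.univ.filter fun l => phiForm δ k / h28 a k < phiForm δ l / h28 a l) : ℤ) : ℝ)) -
          phiForm δ k / h28 a k *
            (F (Finset.univ.filter fun l => phiForm δ k / h28 a k ≤ phiForm δ l / h28 a l) -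
              F (Finset.univ.filter fun l => phiForm δ k / h28 a k < phiForm δ l / h28 a l)) +
          if 0 < phiForm δ k then
            T * (((patternN a 0 (Finset.univ.filter fun l => phiForm δ k / h28 a k ≤ phiForm δ l / h28 a l) : ℤ) : ℝ) -
              ((patternN a 0 (Finset.univ.filter fun l => phiForm δ k / h28 a k < phiForm δ l / h28 a l) : ℤ) : ℝ))
          else 0) =
      T * (torusN δ : ℝ) - translateIntegral a T δ := by
  rw [← sum_firstMoment_eq hpos hT hper hr hsep hend]
  refine Finset.sum_congr rfl fun k _ => ?_
  rw [firstMoment_eq_canonical hpos hT hper hF hr hsep hend hρ hc1 hc2 k]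

end Summit.KontsevichZagierPeriods.Zeta5Search.Barrier.ConeGamma

end
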